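import Summits.BirchSwinnertonDyer.BirchSwinnertonDyer.Theorems.EdixhovenFibreFiveSevenOptimalManinUnitFiveSevenOfReciprocityLaw
import Summits.BirchSwinnertonDyer.BirchSwinnertonDyer.Theorems.EdixhovenFibreFiveSevenStarredOptimalManinUnitFiveSevenCellsOfRecTowerAtIntrinsicAlt
import Summits.BirchSwinnertonDyer.BirchSwinnertonDyer.Theorems.EdixhovenFibreFiveSevenRecTowerUnstarredOrdinaryCells
import Summits.BirchSwinnertonDyer.Rank1Residual.Additive.TwistRamTransport
import Literature.NumberTheory.EllipticCurves.IsogenyPotentiallyGoodMinimalDiscriminantProofs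
import HarnessLib

/-!
# Manin's `p`-part at every lattice-optimal datum on the UNSTARRED (G)-ordinary cells `(5; III)`, `(7; II)`, `(7; IV)`, GRANTED ONLY
# {P1-bar, modularity} — [REC-tower] ELIMINATED; CORNER `KummerCornerTorsionOptimalManinUnit` (stmt-BirchSwinnertonDyer-23883) BY NAME ⟸ {modularity, P1-bar}
# (route `EdixhovenFibreFiveSeven`, line `kato-lever`; seat `bsd-line-edix-p4` g31, width)

HONEST FRAMING. TOOL theorems only (no definition, no named fact, no instance, no `sorry`; file-local instance keys on `ℚ_v` byte-identical to the
accepted `…CellsOfRecTowerAtIntrinsicAlt` l.65–69); helper `--supports` CORNER (stmt-BirchSwinnertonDyer-23883). CORNER stays OPEN — it is proved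
here CONDITIONALLY on modularity (`exists_isNewformOf`, cite-only) and P1-bar (`Kato2004.exists_member_sl2ZetaElement_neron_values_bar`, print XL,
cite-only); **BSD is not proved by any of this.**

WHAT. The conditional closers of record for CORNER / LOW / KP57 / TDS57 (`…OptimalManinUnitFiveSevenOfReciprocityLaw`, `…KPResidueOfReciprocityLaw`,
LEAD g19) take THREE printed inputs: modularity, P1-bar, and Kato's explicit reciprocity law [REC-tower]
(`tatePairingPoint_eq_trace_expStar_log_tower`, through hT₂ `exists_smul_range_expStarCoord_tower_iff_trace_log`), the last one read UNIVERSALLY by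
the per-class socket `katoNeronBody_of_sl2NeronValuesBar_of_isDeRhamAt hT₂`. For K★ the line replaced [REC-tower] by Kato's LOCAL FORMULA proved at the
starred cells (`…CellsOfRecTowerAtIntrinsicAlt` ∘ `…RecTowerCellsOfLocalFormulaAlt` ∘ the LOC stubs, g29–g30, p801055). This file does the same on the
three UNSTARRED ORDINARY cells, where the REC body is now a THEOREM (`RecTowerUnstarredOrdinaryCells.recTowerUnstarredOrdinaryCells`, this seat):

* `cellData_of_unitTwist` — the cell data (`Addv`, `Irr`, no `Iₙ*`, `ord_p Δ_min`) pass from `V₀` to a globally minimal model `Vχ` of the auxiliary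
  unit twist `V₀ ⊗ χ_{q*}` (`q ≠ 2, p`): `AddvUnitTwist`, BSTW, `kodairaSymbolAt_ne_Istar_of_unitTwist`, `padicValInt_minimalDiscriminantInt_eq_of_twist_pStar`.
* ★★ `not_dvd_optimal_c_of_sl2NeronValuesBar_of_unitTwist_of_recAt` — GRANTED a per-cell REC SOCKET `hREC` (the [REC-tower] body at the cyclotomic towers for
  every globally minimal curve with the cell data «additive, `E[p]` irreducible, no `Iₙ*`, `ord_p Δ_min = n`» — the shape every cell file of the line proves):
  the Kosters–Pannekoek repair
  `KPResidueOfReciprocityLaw.not_dvd_optimal_c_of_expStarTower_of_sl2NeronValuesBar_of_unitTwist` VERBATIM with the universal hT₂ replaced, inside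
  `exists_member_not_dvd_c_of_tameTwist57_at`, by `katoNeronBody_of_sl2NeronValuesBar_of_rangeAt` fed with
  `…RecTowerAtBridgeAlt.rangeAt_of_recTowerAtAlt ∘ hREC` at every globally minimal member of the twisted class (cell data moved by
  `cellData_of_unitTwist` and `…CellDataOfIsogenous.cellData_of_isIsogenous`, Dokchitser–Dokchitser 2015 Thm. 5.1 (1) being the tree theorem
  `dokchitser_…_holds`).
* ★★★ `not_dvd_optimal_c_of_sl2NeronValuesBar_of_recAt` — the master theorem `not_dvd_optimal_c_fiveSeven_of_expStarTower_of_sl2NeronValuesBar` (all potentially good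
  cells at `p ∈ {5, 7}`, `D` LATTICE-OPTIMAL at any level ⇒ `p ∤ c(D)`) with hT₂ REPLACED by the socket `hREC` (off the KP exception: the lever `not_dvd_c_of_tameTwist57_at`
  at `W` through the rangeAt socket; on it: the auxiliary unit twist and the previous theorem) — REUSABLE by every cell file (starred, unstarred ordinary, unstarred
  supersingular): plug the cell's REC theorem keyed by `ord_p Δ_min = n`.
* ★★★ `not_dvd_optimal_c_unstarredOrdinary_of_sl2NeronValuesBar` — the socket DISCHARGED on `(p, ord_p Δ_min) ∈ {(5, 3), (7, 2), (7, 4)}` by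
  `RecTowerUnstarredOrdinaryCells.recTowerUnstarredOrdinaryCells` (this seat): `p ∤ c(D)` GRANTED ONLY P1-bar and modularity.
* ★★★ `kummerCornerTorsionOptimalManinUnit_of_sl2NeronValuesBar : exists_isNewformOf → P1-bar → KummerCornerTorsionOptimalManinUnit` — CORNER (23883)
  BY NAME GRANTED ONLY {modularity, P1-bar} (its cells `(5; III)`, `(7; II)` are unstarred ordinary; the (G)-ordinary and torsion binders are not used).

NET: CORNER joins K★ — conditional on the ONE print-XL fact P1-bar (Kato 2004) plus modularity; Kato 1993 II Thm. 1.4.1 (4) is no longer an input on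
these cells. CONDITIONAL; the item stays OPEN; BSD is not proved.

References: [Kato2004Asterisque] Thm. 6.6 (1), (8.1.3), Thm. 9.7; [Kato1993LNM1553] Ch. II Prop. 1.2.3, Thm. 1.4.1 (3)–(4); [KostersPannekoek2017] Thm. 1, Cor. 2;
[Stevens1989] Lemma (5.2); [DokchitserDokchitser2015LocalInvariants] Thm. 5.1 (1); [KrausOesterle1992] Prop. 1; [SilvermanAEC2009] VIII.8, VII.1.
-/

set_option autoImplicit false
-- the Theorems namespace of a single-conjunct summit repeats the summit name by design (D-0017)
set_option linter.dupNamespace false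

noncomputable section

open scoped Classical MatrixGroups NumberField NNReal

open WeierstrassCurve NumberField IsDedekindDomain Field ValuativeRel
  Literature.NumberTheory.EllipticCurves Literature.NumberTheory.EllipticCurves.ModularForms
  Literature.NumberTheory.EllipticCurves.Rank1Residual Literature.NumberTheory.EllipticCurves.Kato2004
  Literature.NumberTheory.DiophantineGeometry Rat.HeightOneSpectrum
  Literature.NumberTheory.PAdicHodge Literature.NumberTheory.GaloisRepresentations
  Literature.NumberTheory.GaloisRepresentations.IsNonarchimedeanLocalField
  Literature.NumberTheory.GaloisRepresentations.PeriodRingData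
  Summit.BirchSwinnertonDyer.Rank1Residual Summit.BirchSwinnertonDyer.Rank1Residual.Additive
  Summit.BirchSwinnertonDyer.Rank1Residual.GaloisImage
  Summit.BirchSwinnertonDyer.BirchSwinnertonDyer.Theorems
  Summit.BirchSwinnertonDyer.BirchSwinnertonDyer.Theorems.KatoAssemblySocketAt
  Summit.BirchSwinnertonDyer.BirchSwinnertonDyer.Theorems.ManinFrameResidueProperRTameTwistAt
  Summit.BirchSwinnertonDyer.BirchSwinnertonDyer.Theorems.KPResidueOfReciprocityLaw
  Summit.BirchSwinnertonDyer.BirchSwinnertonDyer.Theorems.StarredOptimalManinUnitFiveSevenAssemblyAtBarOfRangeAt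
  Summit.BirchSwinnertonDyer.BirchSwinnertonDyer.Theorems.KimAtThreeDeepLowerExpStarOmega
  Summit.BirchSwinnertonDyer.BirchSwinnertonDyer.Theorems.KimAtThreeDeepLowerExpStarOmegaPlace
  Summit.BirchSwinnertonDyer.BirchSwinnertonDyer.Theses.EdixhovenFibreFiveSeven
  CongruenceSubgroup Complex
open Summit.BirchSwinnertonDyer.BirchSwinnertonDyer.Theorems.KimAtThreeDeepUpperTowerLattice (fact_natCast_mem_primesEquiv_symm)
open Literature.NumberTheory.EllipticCurves.FormalGroupChart (padicLogPointFiniteExt)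
open Summit.BirchSwinnertonDyer.BirchSwinnertonDyer.Theorems.TwistDegreeStepFiveSevenUnitTwist

namespace Summit.BirchSwinnertonDyer.BirchSwinnertonDyer.Theorems.UnstarredOrdinaryManinUnitOfSL2NeronValuesBar

-- FILE-LOCAL instance keys, byte-identical to the accepted `…CellsOfRecTowerAtIntrinsicAlt.lean` l.65–69 (no library instance is
-- overridden outside this file): the `Fact (p ∈ v_p)` key and the local-field structures on `ℚ_v = Place.Completion (inr v)`, under
-- which the rangeAt socket `katoNeronBody_of_sl2NeronValuesBar_of_rangeAt` is stated.
attribute [local instance] fact_natCast_mem_primesEquiv_symm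
attribute [local instance 100000] NumberField.Place.instAlgebraCompletion
attribute [local instance] valuativeRelPlace topologicalSpacePlace
attribute [local instance] isNonarchimedeanLocalField_place charZero_place
attribute [local instance] padicAlgebraPlace fact_not_isUnit_place isAdicComplete_place

variable {p : ℕ} [hp : Fact p.Prime]

/-! ### §0 Cell data along the auxiliary unit twist -/

/-- **The cell data pass along the auxiliary unit twist.** For `V₀/ℚ` globally minimal, additive at `p ≠ 2` with `E[p]` irreducible and no `Iₙ*`
fibre at `p`, a prime `q ≠ 2, p`, and a globally minimal model `Vχ = C • V₀ ⊗ χ_{q*}`: `Vχ` is additive at `p`, `E^χ[p]` is irreducible, `Vχ` has no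
`Iₙ*` fibre at `p`, and `ord_p Δ_min(Vχ) = ord_p Δ_min(V₀)` (`q* = 4k + 1` is a `p`-adic unit). [cite: SilvermanAEC2009, VIII.8 and VII.1 Prop. 1.3]
[cite: SilvermanATAEC1994, IV Table 4.1] -/
theorem cellData_of_unitTwist (hp2 : p ≠ 2)
    (V₀ : WeierstrassCurve ℚ) [V₀.IsElliptic] [V₀.IsGloballyMinimal] (hadd : Addv V₀ p) (hirr : Irr V₀ p)
    (hK : ∀ (v : HeightOneSpectrum ℤ) (n : ℕ), natGenerator v = p → V₀.kodairaSymbolAt v ≠ KodairaSymbol.Istar n)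
    {q : ℕ} [Fact q.Prime] (hq2 : q ≠ 2) (hqp : q ≠ p)
    (Vχ : WeierstrassCurve ℚ) [Vχ.IsElliptic] [Vχ.IsGloballyMinimal]
    (C : VariableChange ℚ) (hC : C • V₀.quadraticTwist ((((-1 : ℤ) ^ (q / 2) * q : ℤ)) : ℚ) = Vχ) :
    Addv Vχ p ∧ Irr Vχ p ∧ (∀ (v : HeightOneSpectrum ℤ) (n : ℕ), natGenerator v = p → Vχ.kodairaSymbolAt v ≠ KodairaSymbol.Istar n) ∧
      padicValInt p Vχ.minimalDiscriminantInt = padicValInt p V₀.minimalDiscriminantInt := by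
  have haddχ : Addv Vχ p := AddvUnitTwist.addv_of_model_twist_auxPrime hp2 Fact.out hqp hadd ⟨C, hC⟩
  have hd0 : ((((-1 : ℤ) ^ (q / 2) * q : ℤ)) : ℚ) ≠ 0 := by
    have : ((-1 : ℤ) ^ (q / 2) * q : ℤ) ≠ 0 :=
      mul_ne_zero (pow_ne_zero _ (by norm_num)) (by exact_mod_cast (Fact.out : q.Prime).ne_zero)
    exact_mod_cast this
  have hC' : C⁻¹ • Vχ = V₀.quadraticTwist ((((-1 : ℤ) ^ (q / 2) * q : ℤ)) : ℚ) := by rw [← hC, inv_smul_smul]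
  have hirrχ : Irr Vχ p :=
    BurungaleSkinnerTianWan2024.hasIrreducibleModPGaloisRep_of_smul_eq_quadraticTwist V₀ Vχ p hd0 hC' hirr
  have hKχ := DeRhamAtFiveSeven.kodairaSymbolAt_ne_Istar_of_unitTwist V₀ hq2 hqp Vχ C hC hK
  obtain ⟨k, hk⟩ := DeRhamAtFiveSeven.exists_pStar_eq_four_mul_add_one (q := q) hq2
  have hdp : ((-1 : ℤ) ^ (q / 2) * q : ℤ) = q ∨ ((-1 : ℤ) ^ (q / 2) * q : ℤ) = -q := by
    rcases neg_one_pow_eq_or ℤ (q / 2) with h | h <;> simp [h]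
  have hΔ : padicValInt p Vχ.minimalDiscriminantInt = padicValInt p V₀.minimalDiscriminantInt :=
    Additive.padicValInt_minimalDiscriminantInt_eq_of_twist_pStar q V₀ hk hdp C hC hqp.symm
  exact ⟨haddχ, hirrχ, hKχ, hΔ⟩

section RecAtSocket

/-! ### §1–§2 GRANTED a per-cell REC supplier `hREC` (the socket every cell file plugs into) -/

variable {n : ℕ}
  -- THE SOCKET: the body of [REC-tower] at every cyclotomic tower `ℚ_v ⊆ ℚ(ζ_m)_w`, `p ∤ m`, for EVERY globally minimal curve `W′` carrying the cell data
  -- «additive at `p`, `E[p]` irreducible, no `Iₙ*` fibre at `p`, `ord_p Δ_min = n`» (the conclusion shape of `recTowerUnstarredOrdinaryCells` /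
  -- `recTowerOrdinaryCells_of_localFormulaAlt`, keyed by the value `n` of `ord_p Δ_min` instead of a cell selector)
  (hREC : ∀ (W' : WeierstrassCurve ℚ) [W'.IsElliptic] [W'.IsGloballyMinimal], Addv W' p → Irr W' p →
      (∀ (v : HeightOneSpectrum ℤ) (k : ℕ), natGenerator v = p → W'.kodairaSymbolAt v ≠ KodairaSymbol.Istar k) →
      padicValInt p W'.minimalDiscriminantInt = n →
      ∀ (m : ℕ) [NeZero m], ¬ p ∣ m →
      ∀ (w : ((primesEquiv (R := 𝓞 ℚ)).symm ⟨p, hp.out⟩).Extension (𝓞 (CyclotomicField m ℚ))) (hw : ((p : ℕ) : 𝓞 (CyclotomicField m ℚ)) ∈ w.1.asIdeal)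
      [CharZero (w.1.adicCompletion (CyclotomicField m ℚ))] [Fact (¬ IsUnit ((p : ℕ) : integerC (w.1.adicCompletion (CyclotomicField m ℚ))))]
      [IsAdicComplete (Ideal.span {((p : ℕ) : integerC (w.1.adicCompletion (CyclotomicField m ℚ)))}) (integerC (w.1.adicCompletion (CyclotomicField m ℚ)))]
      (hL : valuation (w.1.adicCompletion (CyclotomicField m ℚ)) ((p : ℕ) : (w.1.adicCompletion (CyclotomicField m ℚ))) < 1), letI := LocalField.adicCompletionPadicAlgebra w.1 p hw
      letI : Algebra (Place.Completion (K := ℚ) (Sum.inr ((primesEquiv (R := 𝓞 ℚ)).symm ⟨p, hp.out⟩))) (w.1.adicCompletion (CyclotomicField m ℚ)) :=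
      inferInstanceAs (Algebra (((primesEquiv (R := 𝓞 ℚ)).symm ⟨p, hp.out⟩).adicCompletion ℚ) (w.1.adicCompletion (CyclotomicField m ℚ)))
      ∀ (wv : Valuation (Place.Completion (Sum.inr ((primesEquiv (R := 𝓞 ℚ)).symm ⟨p, hp.out⟩) : Place ℚ)) ℝ≥0) [wv.Compatible]
      [(W'.baseChange (Place.Completion (Sum.inr ((primesEquiv (R := 𝓞 ℚ)).symm ⟨p, hp.out⟩) : Place ℚ))).IsIntegral wv.integer]
      (ν : Valuation (w.1.adicCompletion (CyclotomicField m ℚ)) ℝ≥0) [ν.Compatible] [(W'.baseChange (w.1.adicCompletion (CyclotomicField m ℚ))).IsIntegral ν.integer]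
      (e : (k : ℕ) → geomTorsion W' ((p ^ k : ℕ) : ℤ) → geomTorsion W' ((p ^ k : ℕ) : ℤ) → AlgebraicClosure ℚ) (hμ : ∀ k S T, e k S T ^ (p ^ k) = 1)
      (hadd₁ : ∀ k S₁ S₂ T, e k (S₁ + S₂) T = e k S₁ T * e k S₂ T) (hadd₂ : ∀ k S T₁ T₂, e k S (T₁ + T₂) = e k S T₁ * e k S T₂)
      (hgal : ∀ k (σ : absoluteGaloisGroup ℚ) (S T : geomTorsion W' ((p ^ k : ℕ) : ℤ)), σ • e k S T = e k (σ • S) (σ • T))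
      (_hnondeg : ∀ k (T : geomTorsion W' ((p ^ k : ℕ) : ℤ)), (∀ S, e k S T = 1) → T = 0) (_halt : ∀ k (S : geomTorsion W' ((p ^ k : ℕ) : ℤ)), e k S S = 1)
      (hcompat : ∀ k (S T : geomTorsion W' ((p ^ (k + 1) : ℕ) : ℤ)),
      e k (torsionMulHom W' (p ^ (k + 1)) (p ^ k) p (pow_succ p k).symm S) (torsionMulHom W' (p ^ (k + 1)) (p ^ k) p (pow_succ p k).symm T) = e (k + 1) S T ^ p)
      (d₀ : LocalNeronLineAt W' p ((primesEquiv (R := 𝓞 ℚ)).symm ⟨p, hp.out⟩)) (d : LocalNeronLine W' hL ((galRestrictPlace ((primesEquiv (R := 𝓞 ℚ)).symm ⟨p, hp.out⟩)).comp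
      (absGaloisRestrict (Place.Completion (Sum.inr ((primesEquiv (R := 𝓞 ℚ)).symm ⟨p, hp.out⟩) : Place ℚ)) (w.1.adicCompletion (CyclotomicField m ℚ))))),
      (bdRPeriodRingData (valuation_place_lt_one p ((primesEquiv (R := 𝓞 ℚ)).symm ⟨p, hp.out⟩))).CupLogInjective (logCyclotomic p)
      (localRationalTateRep W' p (galRestrictPlace ((primesEquiv (R := 𝓞 ℚ)).symm ⟨p, hp.out⟩))) →
      (∀ z : contOneCocycles (localRationalTateRep W' p (galRestrictPlace ((primesEquiv (R := 𝓞 ℚ)).symm ⟨p, hp.out⟩))).toTopRep,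
      (bdRPeriodRingData (valuation_place_lt_one p ((primesEquiv (R := 𝓞 ℚ)).symm ⟨p, hp.out⟩))).HasDualExp (logCyclotomic p)
      (localRationalTateRep W' p (galRestrictPlace ((primesEquiv (R := 𝓞 ℚ)).symm ⟨p, hp.out⟩))) fun σ => z.1 σ) →
      (bdRPeriodRingData (F := (w.1.adicCompletion (CyclotomicField m ℚ))) (p := p) hL).CupLogInjective (logCyclotomic p) (localRationalTateRep W' p
      ((galRestrictPlace ((primesEquiv (R := 𝓞 ℚ)).symm ⟨p, hp.out⟩)).comp (absGaloisRestrict (Place.Completion (Sum.inr ((primesEquiv (R := 𝓞 ℚ)).symm ⟨p, hp.out⟩) : Place ℚ)) (w.1.adicCompletion (CyclotomicField m ℚ))))) →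
      (∀ z : contOneCocycles (localRationalTateRep W' p
      ((galRestrictPlace ((primesEquiv (R := 𝓞 ℚ)).symm ⟨p, hp.out⟩)).comp (absGaloisRestrict (Place.Completion (Sum.inr ((primesEquiv (R := 𝓞 ℚ)).symm ⟨p, hp.out⟩) : Place ℚ)) (w.1.adicCompletion (CyclotomicField m ℚ))))).toTopRep,
      (bdRPeriodRingData (F := (w.1.adicCompletion (CyclotomicField m ℚ))) (p := p) hL).HasDualExp (logCyclotomic p) (localRationalTateRep W' p
      ((galRestrictPlace ((primesEquiv (R := 𝓞 ℚ)).symm ⟨p, hp.out⟩)).comp (absGaloisRestrict (Place.Completion (Sum.inr ((primesEquiv (R := 𝓞 ℚ)).symm ⟨p, hp.out⟩) : Place ℚ)) (w.1.adicCompletion (CyclotomicField m ℚ)))))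
      fun σ => z.1 σ) → (∀ (η₀ : contOneCocycles (restrictedTateRep W' (Place.Completion (Sum.inr ((primesEquiv (R := 𝓞 ℚ)).symm ⟨p, hp.out⟩) : Place ℚ)) p).toTopRep)
      (ηT : contOneCocycles ((restrictedTateRep W' (Place.Completion (Sum.inr ((primesEquiv (R := 𝓞 ℚ)).symm ⟨p, hp.out⟩) : Place ℚ)) p).restrict
      (absGaloisRestrict (Place.Completion (Sum.inr ((primesEquiv (R := 𝓞 ℚ)).symm ⟨p, hp.out⟩) : Place ℚ)) (w.1.adicCompletion (CyclotomicField m ℚ)))).toTopRep),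
      (∀ σ, ηT.1 σ = η₀.1 (absGaloisRestrict (Place.Completion (Sum.inr ((primesEquiv (R := 𝓞 ℚ)).symm ⟨p, hp.out⟩) : Place ℚ)) (w.1.adicCompletion (CyclotomicField m ℚ)) σ)) →
      expStarCoordTower W' (F₀ := (Place.Completion (Sum.inr ((primesEquiv (R := 𝓞 ℚ)).symm ⟨p, hp.out⟩) : Place ℚ))) hL d ηT =
      algebraMap (Place.Completion (Sum.inr ((primesEquiv (R := 𝓞 ℚ)).symm ⟨p, hp.out⟩) : Place ℚ)) (w.1.adicCompletion (CyclotomicField m ℚ))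
      (expStarCoord W' (valuation_place_lt_one p ((primesEquiv (R := 𝓞 ℚ)).symm ⟨p, hp.out⟩)) d₀ η₀)) →
      ∃ c : (Place.Completion (Sum.inr ((primesEquiv (R := 𝓞 ℚ)).symm ⟨p, hp.out⟩) : Place ℚ)), c ≠ 0 ∧
      (∀ (η₀ : contOneCocycles (restrictedTateRep W' (Place.Completion (Sum.inr ((primesEquiv (R := 𝓞 ℚ)).symm ⟨p, hp.out⟩) : Place ℚ)) p).toTopRep)
      (P : (W'.baseChange (Place.Completion (Sum.inr ((primesEquiv (R := 𝓞 ℚ)).symm ⟨p, hp.out⟩) : Place ℚ))).toAffine.Point),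
      ((tatePairingPoint W' (Place.Completion (Sum.inr ((primesEquiv (R := 𝓞 ℚ)).symm ⟨p, hp.out⟩) : Place ℚ)) p e hμ hadd₁ hadd₂ hgal hcompat (oneCocycleClass _ η₀) P : ℤ_[p]) : ℚ_[p]) =
      Algebra.trace ℚ_[p] (Place.Completion (Sum.inr ((primesEquiv (R := 𝓞 ℚ)).symm ⟨p, hp.out⟩) : Place ℚ))
      (c * expStarCoord W' (valuation_place_lt_one p ((primesEquiv (R := 𝓞 ℚ)).symm ⟨p, hp.out⟩)) d₀ η₀ *
      padicLogPointFiniteExt wv (W'.baseChange (Place.Completion (Sum.inr ((primesEquiv (R := 𝓞 ℚ)).symm ⟨p, hp.out⟩) : Place ℚ))) p P)) ∧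
      (∀ (ηT : contOneCocycles ((restrictedTateRep W' (Place.Completion (Sum.inr ((primesEquiv (R := 𝓞 ℚ)).symm ⟨p, hp.out⟩) : Place ℚ)) p).restrict
      (absGaloisRestrict (Place.Completion (Sum.inr ((primesEquiv (R := 𝓞 ℚ)).symm ⟨p, hp.out⟩) : Place ℚ)) (w.1.adicCompletion (CyclotomicField m ℚ)))).toTopRep)
      (P : (W'.baseChange (w.1.adicCompletion (CyclotomicField m ℚ))).toAffine.Point),
      ((tatePairingPointTower W' (Place.Completion (Sum.inr ((primesEquiv (R := 𝓞 ℚ)).symm ⟨p, hp.out⟩) : Place ℚ)) e hμ hadd₁ hadd₂ hgal hcompat (oneCocycleClass _ ηT) P : ℤ_[p]) : ℚ_[p]) =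
      Algebra.trace ℚ_[p] (w.1.adicCompletion (CyclotomicField m ℚ))
      (algebraMap (Place.Completion (Sum.inr ((primesEquiv (R := 𝓞 ℚ)).symm ⟨p, hp.out⟩) : Place ℚ)) (w.1.adicCompletion (CyclotomicField m ℚ)) c * expStarCoordTower W' (F₀ := (Place.Completion (Sum.inr ((primesEquiv (R := 𝓞 ℚ)).symm ⟨p, hp.out⟩) : Place ℚ))) hL d ηT *
      padicLogPointFiniteExt ν (W'.baseChange (w.1.adicCompletion (CyclotomicField m ℚ))) p P)))

set_option maxHeartbeats 800000 in
include hREC in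
/-- ★★ **Manin's `p`-part at a lattice-optimal datum from the auxiliary unit twist, GRANTED P1-bar, modularity and the REC socket `hREC` of the cell.**
`KPResidueOfReciprocityLaw.not_dvd_optimal_c_of_expStarTower_of_sl2NeronValuesBar_of_unitTwist` VERBATIM — data: `V ∼ V₀` globally minimal, additive at `p ∈ {5, 7}`
with `E[p]` irreducible and no `Iₙ*` at `p`, `ord_p Δ_min(V) = n`; `D₀` lattice-optimal on `V₀`; `q ≠ 2, p` good or multiplicative for `V₀`; `Vχ` a globally minimal
model of `V₀ ⊗ χ_{q*}` whose class has no `ℚ_p`-rational point of order `p`; `s² = q*`; (L) `Λ(D₀.f) ⊆ s·Λ(g) + p·Λ(D₀.f)` — with the universal hT₂ REPLACED, inside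
the per-class socket, by `katoNeronBody_of_sl2NeronValuesBar_of_rangeAt` fed by `rangeAt_of_recTowerAtAlt ∘ hREC` at every globally minimal member of the class of
`Vχ` (all carry the cell data of `V`: `cellData_of_unitTwist`, `cellData_of_isIsogenous` with Dokchitser–Dokchitser `dokchitser_…_holds`). Then `p ∤ c(D₀)`.
CONDITIONAL on P1-bar / modularity and the displayed socket. [cite: Kato2004Asterisque, Thm. 6.6 (1) (p. 163), (8.1.3) (p. 180), Thm. 9.7 (p. 189)]
[cite: Kato1993LNM1553, Ch. II Prop. 1.2.3 and Thm. 1.4.1 (3)–(4)] [cite: Stevens1989, Lemma (5.2) p. 96] [cite: KostersPannekoek2017, Thm. 1 and Cor. 2]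
[cite: DokchitserDokchitser2015LocalInvariants, Thm. 5.1 (1)] -/
theorem not_dvd_optimal_c_of_sl2NeronValuesBar_of_unitTwist_of_recAt
    (hP1 : exists_member_sl2ZetaElement_neron_values_bar)
    (hnf : exists_isNewformOf) (hp57 : p = 5 ∨ p = 7)
    (V : WeierstrassCurve ℚ) [V.IsElliptic] [V.IsGloballyMinimal] (hadd : Addv V p) (hirr : Irr V p)
    (hK : ∀ (v : HeightOneSpectrum ℤ) (n : ℕ), natGenerator v = p → V.kodairaSymbolAt v ≠ KodairaSymbol.Istar n)
    (hn : padicValInt p V.minimalDiscriminantInt = n)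
    (V₀ : WeierstrassCurve ℚ) [V₀.IsElliptic] [V₀.IsGloballyMinimal] [NeZero (V₀.conductorNorm ℤ)] (hiso : IsIsogenous V V₀)
    (D₀ : ModularParametrizationData V₀ (V₀.conductorNorm ℤ))
    (hopt₀ : ∀ z ∈ D₀.L.lattice, ∃ w ∈ periodLattice D₀.f, z = D₀.c * w)
    {q : ℕ} [Fact q.Prime] (hq2 : q ≠ 2) (hqp : q ≠ p)
    (hq : V₀.HasGoodReductionAtPrime q ∨ V₀.HasMultiplicativeReductionAtPrime q)
    (Vχ : WeierstrassCurve ℚ) [Vχ.IsElliptic] [Vχ.IsGloballyMinimal] [NeZero (Vχ.conductorNorm ℤ)]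
    (v : VariableChange ℚ) (hv : v • V₀.quadraticTwist (((-1 : ℤ) ^ (q / 2) * q : ℤ) : ℚ) = Vχ)
    (hPTχ : ∀ (W' : WeierstrassCurve ℚ) [W'.IsElliptic] [W'.IsGloballyMinimal], IsIsogenous Vχ W' →
      ∀ P : (W'.baseChange ℚ_[p]).toAffine.Point, p • P = 0 → P = 0)
    (s : ℂ) (hs2 : s ^ 2 = (((-1 : ℤ) ^ (q / 2) * q : ℤ) : ℂ))
    (hL : ∀ (N' : ℕ) [NeZero N'] (g : CuspForm (Gamma0 N') 2), IsNewformOf Vχ g →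
      ∀ z ∈ periodLattice D₀.f, ∃ w ∈ periodLattice g, ∃ y ∈ periodLattice D₀.f,
        z = s * w + (p : ℂ) * y) :
    ¬ (p : ℤ) ∣ D₀.c := by
  have hp2 : p ≠ 2 := by omega
  have hDD := Literature.NumberTheory.EllipticCurves.dokchitser_padicValInt_minimalDiscriminantInt_eq_of_isogeny_of_not_dvd_degree_holds
  -- the cell data of `V₀` (along `V ∼ V₀`, Dokchitser–Dokchitser) and of `Vχ` (along the unit twist)
  obtain ⟨hadd₀, hirr₀, hK₀, hΔ₀⟩ :=
    StarredOptimalManinUnitFiveSevenCellDataOfIsogenous.cellData_of_isIsogenous hDD hiso hp57 hadd hirr hK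
  obtain ⟨haddχ, hirrχ, hKχ, hΔχ⟩ := cellData_of_unitTwist hp2 V₀ hadd₀ hirr₀ hK₀ hq2 hqp Vχ v hv
  have hnχ : padicValInt p Vχ.minimalDiscriminantInt = n := by rw [hΔχ, ← hΔ₀]; exact hn
  -- the lever on the twisted class through the per-class RANGE-AT socket (REC from `hREC` at the members' towers); transported to `Vχ`
  obtain ⟨A, hEA, hMA, DA, hisoA, hcA⟩ := exists_member_not_dvd_c_of_tameTwist57_at hnf Vχ hp57 haddχ hirrχ hPTχ (by
    intro W₀ _ _ hiso₀ M _ g hg hp5 hng hnm hirr' m _ hcop hcl χ hχ hχ1 hord ϖ r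
    -- the cell data of the member `W₀ ∼ Vχ`
    obtain ⟨haddW, hirrW, hKW, hΔW⟩ :=
      StarredOptimalManinUnitFiveSevenCellDataOfIsogenous.cellData_of_isIsogenous hDD hiso₀ hp57 haddχ hirrχ hKχ
    refine katoNeronBody_of_sl2NeronValuesBar_of_rangeAt cupLogInjective_and_hasDualExp_of_isDeRham_holds hP1 W₀ p
      ?_ g hg hp5 hng hnm hirr' m hcop ?_ hcl χ hχ hχ1 hord ϖ r
    · intro w hpw _ _ _ hp' _
      exact DeRhamAtFiveSeven.isDeRham_adicCompletion_rat_fiveSeven W₀ hp57 haddW hirrW hKW w hpw hp'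
    · intro W' _ _ hiso' w hw _ _ _ hL'
      -- the cell data pass to the member `W′ ∼ W₀` (Dokchitser–Dokchitser for `ord_p Δ_min`)
      obtain ⟨hadd', hirr', hK', hΔ'⟩ :=
        StarredOptimalManinUnitFiveSevenCellDataOfIsogenous.cellData_of_isIsogenous hDD hiso' hp57 haddW hirrW hKW
      have hn' : padicValInt p W'.minimalDiscriminantInt = n := by rw [← hΔ', ← hΔW]; exact hnχ
      letI := LocalField.adicCompletionPadicAlgebra w.1 p hw
      letI : Algebra (Place.Completion (K := ℚ) (Sum.inr ((primesEquiv (R := 𝓞 ℚ)).symm ⟨p, hp.out⟩)))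
          (w.1.adicCompletion (CyclotomicField m ℚ)) :=
        inferInstanceAs (Algebra ((((primesEquiv (R := 𝓞 ℚ)).symm ⟨p, hp.out⟩)).adicCompletion ℚ)
          (w.1.adicCompletion (CyclotomicField m ℚ)))
      exact StarredOptimalManinUnitFiveSevenRecTowerAtBridgeAlt.rangeAt_of_recTowerAtAlt W' p ((primesEquiv (R := 𝓞 ℚ)).symm ⟨p, hp.out⟩) hL'
        (hREC W' hadd' hirr' hK' hn' m (KatoAssemblySocket.not_dvd_of_coprime_mul hcop) w hw hL'))
  haveI := hEA
  haveI := hMA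
  obtain ⟨Dχ, hcχ⟩ :=
    ManinFrameTransport.exists_modularParametrizationData_not_dvd_of_partner Vχ hp.out hirrχ hisoA DA hcA
  -- Stevens and the lattice algebra
  exact not_dvd_c_of_twistedPeriodDecomposition D₀ Dχ hp.out hopt₀ hcχ s
    (smul_mem_neronLattice_of_twist D₀ Dχ hq2 hq v hv s hs2) (hL _ Dχ.f Dχ.isNewformOf)

set_option maxHeartbeats 800000 in
include hREC in
/-- ★★★ **Manin's `p`-part at every lattice-optimal datum, GRANTED P1-bar, modularity and the REC socket `hREC` of the cell.** `W/ℚ` globally minimal, additive at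
`p ∈ {5, 7}`, `E[p]` irreducible, no `Iₙ*` fibre at `p`, `ord_p Δ_min(W) = n`, `D` a datum at any level with `Λ_W = c(D)·Λ_f`: `p ∤ c(D)`. The master theorem
`OptimalManinUnitFiveSevenOfReciprocityLaw.not_dvd_optimal_c_fiveSeven_of_expStarTower_of_sl2NeronValuesBar` (LEAD g19) VERBATIM with hT₂ / [REC-tower] REPLACED by the
socket: case `W'(ℚ_p)[p] = 0` for every minimal `W' ∼ W` — the lever `not_dvd_c_of_tameTwist57_at` at `W` through `katoNeronBody_of_sl2NeronValuesBar_of_rangeAt` ∘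
`rangeAt_of_recTowerAtAlt` ∘ `hREC` at the members (cell data by `cellData_of_isIsogenous`; `a_ℓ = ±1` at `ℓ ∥ N` by `lFunction_apply_prime_eq_one_or_eq_neg_one_of_mult`);
otherwise the auxiliary unit twist (`AuxPrime.transferWitness`, `exists_minimal_twist_pStar`, `TorsTwist.torsTwist57_input`, `LTwistTransfer.lTwist_of_transfer`) and
the previous theorem at `V = V₀ = W`. CONDITIONAL on P1-bar / modularity and the displayed socket; nothing is closed.
[cite: Kato2004Asterisque, Thm. 6.6 (1) (p. 163), (8.1.3) (p. 180), Thm. 9.7 (p. 189)] [cite: Kato1993LNM1553, Ch. II Prop. 1.2.3 and Thm. 1.4.1 (3)–(4)]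
[cite: KostersPannekoek2017, Thm. 1 and Cor. 2] [cite: Stevens1989, Lemma (5.2) p. 96] [cite: KrausOesterle1992, Prop. 1] -/
theorem not_dvd_optimal_c_of_sl2NeronValuesBar_of_recAt
    (hP1 : exists_member_sl2ZetaElement_neron_values_bar) (hnf : exists_isNewformOf)
    (W : WeierstrassCurve ℚ) [W.IsElliptic] [W.IsGloballyMinimal] {N : ℕ} [NeZero N]
    (D : ModularParametrizationData W N) (hp57 : p = 5 ∨ p = 7) (hadd : Addv W p) (hirr : Irr W p)
    (hK : ∀ (v : HeightOneSpectrum ℤ) (n : ℕ), natGenerator v = p → W.kodairaSymbolAt v ≠ KodairaSymbol.Istar n)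
    (hn : padicValInt p W.minimalDiscriminantInt = n)
    (hopt : ∀ z ∈ D.L.lattice, ∃ w ∈ periodLattice D.f, z = D.c * w) :
    ¬ (p : ℤ) ∣ D.c := by
  have hN : N = W.conductorNorm ℤ := IsNewformOf.level_eq_conductorNorm_of_exists_isNewformOf hnf D.isNewformOf
  subst hN
  have hDD := Literature.NumberTheory.EllipticCurves.dokchitser_padicValInt_minimalDiscriminantInt_eq_of_isogeny_of_not_dvd_degree_holds
  by_cases hPT : ∀ (W' : WeierstrassCurve ℚ) [W'.IsElliptic] [W'.IsGloballyMinimal], IsIsogenous W W' →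
      ∀ P : (W'.baseChange ℚ_[p]).toAffine.Point, p • P = 0 → P = 0
  · -- off the Kosters–Pannekoek exception: the lever at `W` itself, through the rangeAt socket
    have hpN : p ^ 2 ∣ W.conductorNorm ℤ := sq_dvd_conductorNorm_of_not_good_of_not_mult hadd
    have ha : ∀ ℓ ∈ (W.conductorNorm ℤ).primeFactors, ¬ ℓ ^ 2 ∣ W.conductorNorm ℤ →
        W.LFunction ℓ = 1 ∨ W.LFunction ℓ = -1 := by
      intro ℓ hℓ hℓ2
      haveI : Fact ℓ.Prime := ⟨Nat.prime_of_mem_primeFactors hℓ⟩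
      rcases hasGoodReductionAtPrime_or_hasMultiplicativeReductionAtPrime_of_not_sq_dvd_conductorNorm (V := W) hℓ2
        with hg | hmul
      · exact absurd (Nat.dvd_of_mem_primeFactors hℓ) (not_dvd_conductorNorm_of_hasGoodReductionAtPrime W hg)
      · exact KrausOesterle1992.lFunction_apply_prime_eq_one_or_eq_neg_one_of_mult W ℓ hmul
    refine not_dvd_c_of_tameTwist57_at hp57 W ?_ D hopt (hPT W (isIsogenous_self W)) hadd hirr hpN ha
    intro M _ g hg hp5' hng hnm hirr' m _ hcop hcl χ hχ hχ1 hord' ϖ r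
    refine katoNeronBody_of_sl2NeronValuesBar_of_rangeAt cupLogInjective_and_hasDualExp_of_isDeRham_holds hP1 W p
      ?_ g hg hp5' hng hnm hirr' m hcop ?_ hcl χ hχ hχ1 hord' ϖ r
    · intro v hpv _ _ _ hp' _
      exact DeRhamAtFiveSeven.isDeRham_adicCompletion_rat_fiveSeven W hp57 hadd hirr hK v hpv hp'
    · intro W' _ _ hiso' w hw _ _ _ hL'
      obtain ⟨hadd', hirr', hK', hΔ'⟩ :=
        StarredOptimalManinUnitFiveSevenCellDataOfIsogenous.cellData_of_isIsogenous hDD hiso' hp57 hadd hirr hK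
      have hn' : padicValInt p W'.minimalDiscriminantInt = n := by rw [← hΔ']; exact hn
      letI := LocalField.adicCompletionPadicAlgebra w.1 p hw
      letI : Algebra (Place.Completion (K := ℚ) (Sum.inr ((primesEquiv (R := 𝓞 ℚ)).symm ⟨p, hp.out⟩)))
          (w.1.adicCompletion (CyclotomicField m ℚ)) :=
        inferInstanceAs (Algebra ((((primesEquiv (R := 𝓞 ℚ)).symm ⟨p, hp.out⟩)).adicCompletion ℚ)
          (w.1.adicCompletion (CyclotomicField m ℚ)))
      exact StarredOptimalManinUnitFiveSevenRecTowerAtBridgeAlt.rangeAt_of_recTowerAtAlt W' p ((primesEquiv (R := 𝓞 ℚ)).symm ⟨p, hp.out⟩) hL'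
        (hREC W' hadd' hirr' hK' hn' m (KatoAssemblySocket.not_dvd_of_coprime_mul hcop) w hw hL')
  · -- on it: the auxiliary unit twist at `W` itself, then §1
    push Not at hPT
    obtain ⟨W', hE', hM', hisoW', P, hP, hP0⟩ := hPT
    obtain ⟨q, hq, hq2, hqp, hqN', hnsq, hu⟩ := AuxPrime.transferWitness p W hp57 hadd hirr
    haveI : Fact q.Prime := ⟨hq⟩
    have hqsq : ¬ q ^ 2 ∣ W.conductorNorm ℤ := fun h ↦ hqN' ((dvd_pow_self q two_ne_zero).trans h)
    have hgm : W.HasGoodReductionAtPrime q ∨ W.HasMultiplicativeReductionAtPrime q :=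
      hasGoodReductionAtPrime_or_hasMultiplicativeReductionAtPrime_of_not_sq_dvd_conductorNorm (V := W) hqsq
    obtain ⟨Vχ, hEχ, hMχ, v, hv⟩ := exists_minimal_twist_pStar q W
    haveI := hEχ
    haveI := hMχ
    haveI : NeZero (Vχ.conductorNorm ℤ) := ⟨(Vχ.conductorNorm_pos_holds).ne'⟩
    have hv' : v • W.quadraticTwist (((-1 : ℤ) ^ (q / 2) * q : ℤ) : ℚ) = Vχ := by
      rw [(pStar_intCast q).1]; exact hv
    obtain ⟨s, hs2⟩ := IsAlgClosed.exists_pow_nat_eq ((((-1 : ℤ) ^ (q / 2) * q : ℤ)) : ℂ) two_pos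
    have hPTχ := TorsTwist.torsTwist57_input p q W hp57 hadd hirr hqp hnsq ⟨W', hE', hM', P, hisoW', hP0, hP⟩ Vχ v hv'
    have hL : ∀ (N' : ℕ) [NeZero N'] (g : CuspForm (Gamma0 N') 2), IsNewformOf Vχ g →
        ∀ z ∈ periodLattice D.f, ∃ w ∈ periodLattice g, ∃ y ∈ periodLattice D.f, z = s * w + (p : ℂ) * y :=
      fun N' _ g hg ↦ LTwistTransfer.lTwist_of_transfer W D hq2 hqp hqN' hu Vχ v hv' s hs2 g hg
    exact not_dvd_optimal_c_of_sl2NeronValuesBar_of_unitTwist_of_recAt hREC hP1 hnf hp57 W hadd hirr hK hn W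
      (isIsogenous_self W) D hopt hq2 hqp hgm Vχ v hv' hPTχ s hs2 hL

end RecAtSocket

/-! ### §3 The unstarred (G)-ordinary cells: socket discharged; CORNER by name -/

/-- ★★★ **Manin's `p`-part at every lattice-optimal datum of every `W/ℚ` on the UNSTARRED (G)-ordinary cells at `p ∈ {5, 7}`, GRANTED ONLY P1-bar and
modularity.** `W` globally minimal, additive at `p`, `E[p]` irreducible, `(p, ord_p Δ_min) ∈ {(5, 3), (7, 2), (7, 4)}` (Kodaira III at `5`; II, IV at `7`: potentially
good ORDINARY), `D` a datum at any level with `Λ_W = c(D)·Λ_f`: `p ∤ c(D)` — `not_dvd_optimal_c_of_sl2NeronValuesBar_of_recAt` with the socket DISCHARGED by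
`RecTowerUnstarredOrdinaryCells.recTowerUnstarredOrdinaryCells` (this seat, p802720); no `Iₙ*` from `ord_p Δ_min ≤ 4`. [REC-tower] is NO LONGER an input here.
CONDITIONAL on P1-bar / modularity (cite-only); nothing is closed. [cite: Kato2004Asterisque, Thm. 6.6 (1) (p. 163), (8.1.3) (p. 180), Thm. 9.7 (p. 189)]
[cite: Kato1993LNM1553, Ch. II Thm. 1.4.1 (3)–(4)] [cite: KostersPannekoek2017, Thm. 1 and Cor. 2] -/
theorem not_dvd_optimal_c_unstarredOrdinary_of_sl2NeronValuesBar
    (hP1 : exists_member_sl2ZetaElement_neron_values_bar) (hnf : exists_isNewformOf)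
    (W : WeierstrassCurve ℚ) [W.IsElliptic] [W.IsGloballyMinimal] {N : ℕ} [NeZero N]
    (D : ModularParametrizationData W N) (hp57 : p = 5 ∨ p = 7) (hadd : Addv W p) (hirr : Irr W p)
    (hcell : p = 5 ∧ padicValInt p W.minimalDiscriminantInt = 3 ∨ p = 7 ∧ padicValInt p W.minimalDiscriminantInt = 2 ∨
      p = 7 ∧ padicValInt p W.minimalDiscriminantInt = 4)
    (hopt : ∀ z ∈ D.L.lattice, ∃ w ∈ periodLattice D.f, z = D.c * w) :
    ¬ (p : ℤ) ∣ D.c := by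
  have hp5 : 5 ≤ p := by omega
  have h4 : padicValInt p W.minimalDiscriminantInt ≤ 4 := by rcases hcell with ⟨-, h⟩ | ⟨-, h⟩ | ⟨-, h⟩ <;> omega
  have hK : ∀ (v : HeightOneSpectrum ℤ) (n : ℕ), natGenerator v = p → W.kodairaSymbolAt v ≠ KodairaSymbol.Istar n :=
    OptimalManinUnitFiveSevenOfReciprocityLaw.forall_ne_Istar_of_padicValInt_le_four W hp5 hadd h4
  refine not_dvd_optimal_c_of_sl2NeronValuesBar_of_recAt (n := padicValInt p W.minimalDiscriminantInt) ?_ hP1 hnf W D hp57 hadd hirr hK rfl hopt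
  intro W' _ _ hadd' hirr' hK' hn'
  have hcell' : p = 5 ∧ padicValInt p W'.minimalDiscriminantInt = 3 ∨ p = 7 ∧ padicValInt p W'.minimalDiscriminantInt = 2 ∨
      p = 7 ∧ padicValInt p W'.minimalDiscriminantInt = 4 := by rw [hn']; exact hcell
  exact RecTowerUnstarredOrdinaryCells.recTowerUnstarredOrdinaryCells W' p hp57 hadd' hirr' hK' hcell'

/-- ★★★ **CORNER `KummerCornerTorsionOptimalManinUnit` (stmt-BirchSwinnertonDyer-23883; this route's copy, shared verbatim with route TeichmullerTwistDescent)
GRANTED ONLY modularity and P1-bar — Kato's explicit reciprocity law [REC-tower] is NO LONGER an input** (it is the theorem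
`recTowerUnstarredOrdinaryCells` on the corner cells `(5; III)`, `(7; II)`). The (G)-ordinary and torsion binders are not used. CONDITIONAL on the two
cite-only facts; the item stays OPEN; BSD is not proved by this. [cite: Kato2004Asterisque, Thm. 6.6 (1) (p. 163), (8.1.3) (p. 180), Thm. 9.7 (p. 189)]
[cite: KostersPannekoek2017, Cor. 2] [cite: Kato1993LNM1553, Ch. II Thm. 1.4.1 (3)–(4)] -/
theorem kummerCornerTorsionOptimalManinUnit_of_sl2NeronValuesBar (hnf : exists_isNewformOf)
    (hP1 : exists_member_sl2ZetaElement_neron_values_bar) :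
    KummerCornerTorsionOptimalManinUnit := by
  intro W _ _ p _ _ D hcell hadd hirr _ _ hopt
  have hp57 : p = 5 ∨ p = 7 := by rcases hcell with ⟨h, -⟩ | ⟨h, -⟩ <;> simp [h]
  have hcell' : p = 5 ∧ padicValInt p W.minimalDiscriminantInt = 3 ∨ p = 7 ∧ padicValInt p W.minimalDiscriminantInt = 2 ∨
      p = 7 ∧ padicValInt p W.minimalDiscriminantInt = 4 := by
    rcases hcell with h | h
    · exact Or.inl h
    · exact Or.inr (Or.inl h)
  exact not_dvd_optimal_c_unstarredOrdinary_of_sl2NeronValuesBar hP1 hnf W D hp57 hadd hirr hcell' hopt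

end Summit.BirchSwinnertonDyer.BirchSwinnertonDyer.Theorems.UnstarredOrdinaryManinUnitOfSL2NeronValuesBar

end
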